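import Summits.CriticalPhenomena.PercolationContinuityZ3.Theorems.PercNearOneGluingNoHeavyLowerTailSahiLatinZeroBottomCoupling
import Summits.CriticalPhenomena.PercolationContinuityZ3.Theorems.PercNearOneGluingNoHeavyLowerTailSahiLatinZeroBottomConjFamily

/-!
# `NoHeavyLowerTail` (crux stmt-CriticalPhenomena-4575), Sahi programme (prim-master-conj gen 50): **TOP-SLICE DOMINANCE WITH THE SHARP CONSTANT `3/2`
# ON THE PRIVATE-CUT ZERO-BOTTOM FAMILY** — `P′`, `Q′` ARBITRARY up-sets with disjoint supports, `P = P′ ∩ C_P`, `Q = Q′ ∩ C_Q` cut by arbitrary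
# private cylinders; every dimension

Support file (`--supports stmt-CriticalPhenomena-4575`; one inductive predicate + proofs, no `sorry`, standard axioms).  Memo
`run/shared/lean/prim/prim-l12/FROM-prim-master-conj-g50-GENERAL-CORE.md` §6.  Nothing here asserts the crux, Kahn's conjecture or (C¼) in general.

THE MATHEMATICS.  The family `IsCutPad κ P b Q c` is generated from the GENERAL CORES `P = S × Ω`, `b = Sᶜ × Ω`, `Q = Ω × T`, `c = Ω × Tᶜ` on `[3]^{U ⊕ V}`
(`S ⊆ [3]^U`, `T ⊆ [3]^V` arbitrary; `grid4_core`) by the two FACTOR LIFTS of `…ZeroBottomCoupling`: for an arbitrary UP-SET `A ⊆ [3]^W` on a new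
block `W`, `(P, b, Q, c) ↦ (A × P, A × b, Ω × Q, Ω × c)` (`grid4_factorP`) and symmetrically on the `Q`-side (`grid4_factorQ`).  Free coordinates
(`A = Ω`) and gen 49's literal primes (`|W| = 1`, `A = {2}` or `{1,2}`) are special cases, so `IsCutPad` contains (up to re-indexing) the padded
single-bridge family `IsBridgePad` (gen 49) and the conjunctive family `IsConjPad` (this generation).  In prim-ineq-gen-4's zero-bottom language the
members are exactly (up to re-indexing of the axes): `P′ = A × Ω`, `P = A × P_U × Ω`, `Q′ = B × Ω`, `Q = B × Q_V × Ω` with `A ⊆ [3]^{W₁}`, `B ⊆ [3]^{W₂}`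
ARBITRARY UP-SETS (clauses, non-literal primes, anything), `P_U ⊆ [3]^U`, `Q_V ⊆ [3]^V` arbitrary, on pairwise disjoint blocks `W₁, U, W₂, V`: the
primes `P′, Q′` are arbitrary up-sets with DISJOINT SUPPORTS and the steps `P ⊂ P′`, `Q ⊂ Q′` are CUTS BY PRIVATE CYLINDERS.
**THEOREM (`three_kappa_top_le_two_kappa_lowerStep_of_isCutPad`).**  For every member and every up-set `F ⊇ P ∪ Q`:
   `3 · κ(F, P ∪ b, Q ∪ c) ≤ 2 · κ(ofSections F F F, ofSections P P (P ∪ b), ofSections Q Q (Q ∪ c))`   (`4c₁ ≥ 3c₃`; TOP₁ with the sharp constant `3/2`).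
NOT covered: non-private cuts (`P′` relaxing `P` on `P`'s own coordinates, e.g. `P = [x_i = 2]∧P̃ ⊂ P′ = [x_i ≥ 1]∧P̃′`) and primes `P′, Q′` with a common
coordinate; (C¼), top-slice dominance in general, `PatternPos d ≥ 5`, Kahn's conjecture remain OPEN. [this work]
-/

namespace Summit.CriticalPhenomena.PercolationContinuityZ3.Theorems.SahiLatin

open Finset

/-! ## §1  The family -/

/-- **The private-cut zero-bottom family** (general cores, closed under up-set factor lifts on either side). [this work] -/
inductive IsCutPad : ∀ (κ : Type) [Fintype κ] [DecidableEq κ], Finset (Pt κ) → Finset (Pt κ) → Finset (Pt κ) → Finset (Pt κ) → Prop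
  | core {U V : Type} [Fintype U] [DecidableEq U] [Fintype V] [DecidableEq V] (S : Finset (Pt U)) (T : Finset (Pt V)) :
      IsCutPad (U ⊕ V) (cylL S) (cylL Sᶜ) (cylR T) (cylR Tᶜ)
  | factorP {W κ : Type} [Fintype W] [DecidableEq W] [Fintype κ] [DecidableEq κ] {A : Finset (Pt W)} (hA : IsUpperSet (A : Set (Pt W)))
      {P b Q c : Finset (Pt κ)} :
      IsCutPad κ P b Q c → IsCutPad (W ⊕ κ) (cylL A ∩ cylR P) (cylL A ∩ cylR b) (cylR Q) (cylR c)
  | factorQ {W κ : Type} [Fintype W] [DecidableEq W] [Fintype κ] [DecidableEq κ] {B : Finset (Pt W)} (hB : IsUpperSet (B : Set (Pt W)))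
      {P b Q c : Finset (Pt κ)} :
      IsCutPad κ P b Q c → IsCutPad (W ⊕ κ) (cylR P) (cylR b) (cylL B ∩ cylR Q) (cylL B ∩ cylR c)

/-! ## §2  The grid invariant on the family -/

/-- **`Grid4` holds on the whole private-cut family** (general core + generalised pairing lemmas). [this work] -/
theorem grid4_of_isCutPad {κ : Type} [Fintype κ] [DecidableEq κ] {P b Q c : Finset (Pt κ)} (h : IsCutPad κ P b Q c) : Grid4 P b Q c := by
  induction h with
  | core S T => exact grid4_core S T
  | factorP hA _ ih => exact grid4_factorP hA ih
  | factorQ hB _ ih => exact grid4_factorQ hB ih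

/-! ## §3  Invariants through the factor lifts -/

section lifts
variable {W κ : Type} [Fintype W] [DecidableEq W] [Fintype κ] [DecidableEq κ]

omit [Fintype W] [Fintype κ] in
/-- Updating a second-block coordinate acts on the second block. [this work] -/
theorem sndPt_update_inr (u : Pt (W ⊕ κ)) (k : κ) (v : Fin 3) : sndPt (Function.update u (Sum.inr k) v) = Function.update (sndPt u) k v := by
  funext j
  by_cases h : j = k
  · subst h; simp [sndPt]
  · rw [Function.update_of_ne h]; simp [sndPt, Function.update_of_ne, h]

/-- A `P`-inessential axis `k` stays inessential for `A × P` (axis `inr k`). [this work] -/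
theorem axisInessential_prod_inr {A : Finset (Pt W)} {X : Finset (Pt κ)} {k : κ} (h : AxisInessential X k) :
    AxisInessential ((cylL A : Finset (Pt (W ⊕ κ))) ∩ cylR X) (Sum.inr k) := by
  intro x v
  rw [mem_inter, mem_inter, mem_cylL, mem_cylL, mem_cylR, mem_cylR, fstPt_update_inr, sndPt_update_inr, h]

/-- A `X`-inessential axis `k` stays inessential for the cylinder `Ω × X` (axis `inr k`). [this work] -/
theorem axisInessential_cylR_inr {X : Finset (Pt κ)} {k : κ} (h : AxisInessential X k) :
    AxisInessential (cylR X : Finset (Pt (W ⊕ κ))) (Sum.inr k) := by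
  intro x v
  rw [mem_cylR, mem_cylR, sndPt_update_inr, h]

/-- Independence lifts through a `P`-side factor. [this work] -/
theorem indep_factorP (A : Finset (Pt W)) {P Q : Finset (Pt κ)} (h : Indep P Q) :
    Indep ((cylL A : Finset (Pt (W ⊕ κ))) ∩ cylR P) (cylR Q) := by
  intro i
  cases i with
  | inl a => exact Or.inr (axisInessential_cylR_inl Q a)
  | inr k =>
    rcases h k with hk | hk
    · exact Or.inl (axisInessential_prod_inr hk)
    · exact Or.inr (axisInessential_cylR_inr hk)

/-- Disjointness lifts through a factor. [this work] -/
theorem disjoint_factor (A : Finset (Pt W)) {X Y : Finset (Pt κ)} (h : Disjoint X Y) :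
    Disjoint ((cylL A : Finset (Pt (W ⊕ κ))) ∩ cylR X) (cylL A ∩ cylR Y) := by
  rw [disjoint_left]
  intro u hu hu'
  rw [mem_inter, mem_cylR] at hu hu'
  exact disjoint_left.1 h hu.2 hu'.2

/-- Disjointness lifts through a cylinder. [this work] -/
theorem disjoint_cylR {X Y : Finset (Pt κ)} (h : Disjoint X Y) : Disjoint (cylR X : Finset (Pt (W ⊕ κ))) (cylR Y) := by
  rw [disjoint_left]
  intro u hu hu'
  rw [mem_cylR] at hu hu'
  exact disjoint_left.1 h hu hu'

end lifts

/-- The invariants carried along the family: `P ∩ b = ∅`, `Q ∩ c = ∅`, `P ⊥ Q`. [this work] -/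
theorem invariants_of_isCutPad {κ : Type} [Fintype κ] [DecidableEq κ] {P b Q c : Finset (Pt κ)} (h : IsCutPad κ P b Q c) :
    Disjoint P b ∧ Disjoint Q c ∧ Indep P Q := by
  induction h with
  | core S T => exact invariants_core S T
  | @factorP W κ _ _ _ _ A hA P b Q c _ ih => exact ⟨disjoint_factor A ih.1, disjoint_cylR ih.2.1, indep_factorP A ih.2.2⟩
  | @factorQ W κ _ _ _ _ B hB P b Q c _ ih => exact ⟨disjoint_cylR ih.1, disjoint_factor B ih.2.1, (indep_factorP B ih.2.2.symm).symm⟩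

/-! ## §4  The theorem -/

/-- **TOP-SLICE DOMINANCE WITH THE SHARP CONSTANT `3/2` ON THE PRIVATE-CUT ZERO-BOTTOM FAMILY** (every dimension): for every member `(P, b, Q, c)` of
`IsCutPad` (with `P′ = P ∪ b`, `Q′ = Q ∪ c`) and every up-set `F ⊇ P ∪ Q`,
`3 · κ(F, P′, Q′) ≤ 2 · κ(ofSections F F F, ofSections P P P′, ofSections Q Q Q′)`. [this work] -/
theorem three_kappa_top_le_two_kappa_lowerStep_of_isCutPad {κ : Type} [Fintype κ] [DecidableEq κ] {P b Q c : Finset (Pt κ)}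
    (h : IsCutPad κ P b Q c) {F : Finset (Pt κ)} (hF : IsUpperSet (F : Set (Pt κ))) (hPQ : P ∪ Q ⊆ F) :
    3 * kappa F (P ∪ b) (Q ∪ c) ≤ 2 * kappa (ofSections F F F) (ofSections P P (P ∪ b)) (ofSections Q Q (Q ∪ c)) := by
  obtain ⟨hPb, hQc, hI⟩ := invariants_of_isCutPad h
  have h0 : kappa F P Q = 0 := kappa_eq_zero_of_indep_of_union_subset hI hPQ
  have hb : (P ∪ b) \ P = b := by
    rw [union_sdiff_left, Finset.sdiff_eq_self_iff_disjoint]; exact hPb.symm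
  have hc : (Q ∪ c) \ Q = c := by
    rw [union_sdiff_left, Finset.sdiff_eq_self_iff_disjoint]; exact hQc.symm
  have key := (three_kappa_top_le_iff_psi_nonneg (F := F) (subset_union_left (s₁ := P) (s₂ := b))
    (subset_union_left (s₁ := Q) (s₂ := c)) h0).2
  rw [hb, hc] at key
  exact key (psi_nonneg_of_grid4 (grid4_of_isCutPad h) hF hPQ)

/-- The same theorem in "`Ψ ≥ 0`" form. [this work] -/
theorem psi_nonneg_of_isCutPad {κ : Type} [Fintype κ] [DecidableEq κ] {P b Q c : Finset (Pt κ)}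
    (h : IsCutPad κ P b Q c) {F : Finset (Pt κ)} (hF : IsUpperSet (F : Set (Pt κ))) (hPQ : P ∪ Q ⊆ F) : 0 ≤ Psi F P b Q c :=
  psi_nonneg_of_grid4 (grid4_of_isCutPad h) hF hPQ

end Summit.CriticalPhenomena.PercolationContinuityZ3.Theorems.SahiLatin
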